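import Literature.Probability.RandomPlanarGeometry.SAWBridgeSparseLevels
import Literature.Probability.RandomPlanarGeometry.SAWBridgeZigzag
import Literature.Combinatorics.BinomialRatioLowerBound
import Mathlib.Analysis.SpecialFunctions.Pow.Real
import HarnessLib

/-!
# Duminil-Copin–Hammond 2013, Proposition 3.2: the entropy/trichotomy assembly from per-`n` counts

Topic `Literature/Probability/RandomPlanarGeometry` (continues `SAWBridgeSparseLevels.lean` — the objects
`highBridges` = `SAB_{n,v}`, `levelVisits` = `|V_{h,h+1}|`, `sparseLevelCount`, `sparseHighBridges` = `SAB^m_{n,v,δ}`,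
`renewalCount` = `|R_γ|` and the typed Proposition `DCH_prop32`; `SAWBridgeZigzag.lean` — zigzags, their
unfolding, renewal times and level counts; `Literature/Combinatorics/BinomialRatioLowerBound.lean` — Lemma 3.8).

Source: H. Duminil-Copin, A. Hammond, *Self-avoiding walk is sub-ballistic*, Comm. Math. Phys. **324**
(2013) 401–423, arXiv:1205.0401 (held text `paper:arxiv-1205.0401`, locators `pNNNN:Lk` = chunk:line; `arXiv v1, p. N` in
the `[cite: …]` tags = printed page of arXiv:1205.0401v1), §3:
**Proposition 3.2** (p0008:L30–L36) "Let `v > 0`. Let `k ≥ 2`. Let `δ > 0` and `{u_n}` be a subsequence of `ℕ`.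
Then there exist `δ' > 0` and a subsequence `{v_n}` of `{u_n}` such that
`lim (1/v_n) log(|SAB^k_{v_n,v,δ}| / |SAB^{k-1}_{v_n,v,δ'}|) = 0`", typed (lane «pcv-sawmu», a-idea-2's
`Sketch_v8_DCH11`, a-p3's `DCH_prop32`) in the one-sided multiplicative form that its proof establishes and
that Theorem 3.1 uses: `|SAB^k_{v_n,v,δ}| ≤ e^{ε_n v_n} |SAB^{k-1}_{v_n,v,δ'}|`, `ε_n → 0`. Its printed proof
(p0009:L7–p0011:L17) is a trichotomy — Case 1 "many renewal points" (nothing to prove: a renewal time gives a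
singly-crossed level), Case 2 "few zigzags" (unfold all zigzags; multi-valued map principle with preimage
bound `C(u_n, 2ε_n u_n)`), Case 3 "many zigzags and few renewal points" (unfold `δ''v_n` short zigzags;
forward entropy `C(δ'v_n, δ''v_n)`, backward entropy from the renewal points of the image; Lemma 3.8).

## What this file proves (no definitions, no named facts)

The ANALYTIC and LOGICAL part of that proof, once and for all, over an ABSTRACT zigzag statistic
`Zc n γ : ℕ` and two per-`n` COUNT inequalities that the combinatorial (zigzag-unfolding) layer supplies:
* `dch_prop32At_of_counts` — for fixed `d, v, k ≥ 2, δ > 0`: from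
  **H2** `#{γ ∈ SAB^k_{n,v,δ} : Zc γ ≤ m} ≤ (Σ_{s ≤ 2m} C(n+1, s)) · #SAB^{k-1}_{n,v,δ}` (all `n, m`) and
  **H3** `#{γ ∈ SAB^k_{n,v,δ} : a + ⌊n/(L+1)⌋ ≤ Zc γ ∧ |R_γ| ≤ r} · C(a, t) ≤ C((r + 3Lt)·L, t) · #{φ ∈ SAB_{n,v} : t ≤ |R_φ|}`
  (all `n, L ≥ 1, t, a, r`), the conclusion of Proposition 3.2 for every subsequence `u`;
* `dch_prop32_of_counts` — the same packaged as `DCH_prop32` (all `d ≥ 2, v > 0, k ≥ 2, δ > 0`);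
* the two entropy lemmas of Case 2, `sum_range_choose_le_div_pow_mul_exp` (`Σ_{s ≤ K} C(N,s) ≤ (N/K)^K e^K`)
  and `log_sum_range_choose_le` (`log Σ_{s ≤ K} C(N,s) ≤ 2√(NK) + K`), and H1 = Case 1's mechanism
  `renewalCount_le_sparseLevelCount_one_succ` (from `SAWBridgeZigzag`).
In the lane's «DCH-1.1» programme H2 is `card_sparseHighBridges_filter_card_zigzags_le` (Case 2 count) and H3
is `card_sparseHighBridges_filter_zigzags_mul_choose_le` (Case 3 count), both over
`Zc n γ = #{(i,j) ∈ Z(γ) : i < j}` (non-degenerate zigzags); they are hypotheses here, so this file waits on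
neither.

## How the printed argument is organised here (choices, with the printed counterpart)

The printed `ε_n ↘ 0` / "positive proportion" case split is made along the given subsequence `u` with FIXED
rational thresholds (custodian's derivation in the lane's `DCH11_BLUEPRINT.md` §2 Z6, simplified: no diagonal
sequence is needed for the renewal threshold). CASE 2 holds iff for every `m`, frequently along `u`, a quarter
of `SAB^k_{N,v,δ}` has `Zc ≤ N/(m+1)`; then along the diagonal subsequence (`Filter.extraction_forall_of_frequently`,
`m = n`) H2 costs `4 Σ_{s ≤ 2⌊N/(n+1)⌋} C(N+1, s) = e^{ε_n N}` with
`ε_n ≤ log 4/(n+1) + 4√(1/(n+1)) + 2/(n+1) → 0` and `δ' = δ`. Otherwise fix `m₀` with, eventually, fewer than a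
quarter having `Zc ≤ N/(m₀+1)`; put `L = 2m₀+1`, `c₁ = 8(L+1)(m₀+1)`, `c₂ = 32L(L+1)(m₀+1)`. CASE 1: frequently a
quarter has `|R_γ| ≥ ⌊N/c₁⌋ + 2` — then (H1) those walks lie in `SAB^{k-1}_{N,v,1/c₁}`, ratio `4`, `δ' = 1/c₁`.
CASE 3: eventually at least half of `SAB^k_{N,v,δ}` has `Zc > N/(m₀+1)` and `|R_γ| ≤ ⌊N/c₁⌋ + 1 =: r`; with
`a = ⌊N/(m₀+1)⌋ + 1 - ⌊N/(2(m₀+1))⌋` (so `a + ⌊N/(L+1)⌋ = ⌊N/(m₀+1)⌋ + 1`), `t = ⌊N/c₂⌋ + 2` one checks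
`a - t ≥ 2(L+1)(r + 3Lt)` for `N ≥ 22(m₀+1)(4 + 14L + 12L²)` (margin `3N/(64(m₀+1))`), whence Lemma 3.8 gives
`C(a,t) ≥ 2^t C((r+3Lt)L, t)`, H3 gives `#A ≤ #B`, and H1 puts the images in `SAB^{k-1}_{N,v,1/c₂}`: ratio `2`,
`δ' = 1/c₂`. In all cases `δ'` is a fixed positive constant and `ε_n = log c / N → 0`.
AS-PRINTED DELTAS recorded by the lane (lit-1/lit-2/a-idea-2): the one-sided form of Prop 3.2; Case 3's
multi-valued map runs over NON-degenerate zigzags (`Unf_{(i,i)} = id`); the backward code is the `t`-set of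
unfolded pairs itself (`≤ |R_φ|·L` candidates), not the printed zig-set × zag-offsets.

Tree-twin search (`lean search`): `prop32`, `extraction_forall_of_frequently` users, `sum_range_choose` — no twin;
Lemma 3.8 is `Literature.Combinatorics.DuminilCopinHammond2013_lemma38`.
-/

noncomputable section

open Finset Filter Topology Literature.Probability.LatticeModels Literature.Probability.Percolation
open scoped BigOperators

namespace Literature.Probability.RandomPlanarGeometry.SAW.Zd

variable {d : ℕ} [NeZero d]


/-! ### Elementary facts about the objects -/

/-- Membership in `SAB_{n,v}`. [cite: DuminilCopinHammond2013, §3, eq. (3.1)] -/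
theorem mem_highBridges {n : ℕ} {v : ℝ} {ω : ℕ → Site d} :
    ω ∈ highBridges d n v ↔ ω ∈ bridges d n ∧ v * (n : ℝ) ≤ ((ω n 0 : ℤ) : ℝ) := by
  classical
  exact Finset.mem_filter

/-- Membership in `SAB^m_{n,v,δ}`. [cite: DuminilCopinHammond2013, §3 (arXiv v1, p. 11)] -/
theorem mem_sparseHighBridges {n m : ℕ} {v δ : ℝ} {ω : ℕ → Site d} :
    ω ∈ sparseHighBridges d n v δ m ↔ ω ∈ highBridges d n v ∧ δ * (n : ℝ) ≤ (sparseLevelCount m n ω : ℝ) := by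
  classical
  exact Finset.mem_filter

/-- `sparseLevelCount` is monotone in the visit bound `m`. [cite: DuminilCopinHammond2013, §3 (arXiv v1, p. 11)] -/
theorem sparseLevelCount_mono {m m' : ℕ} (h : m ≤ m') (n : ℕ) (ω : ℕ → Site d) :
    sparseLevelCount m n ω ≤ sparseLevelCount m' n ω := by
  classical
  unfold sparseLevelCount
  refine Finset.card_le_card fun x hx => ?_
  simp only [Finset.mem_filter] at hx ⊢
  exact ⟨hx.1, hx.2.trans h⟩

/-! ### H1 — renewal times give singly-crossed levels (Case 1 mechanism, p0009:L21–L23) -/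

/-- **H1** in the lane's counting vocabulary: for a bridge, `|R_γ| ≤ #{0 ≤ h < y(γ_n) : |V_{h,h+1}| ≤ 1} + 1`.
This is `card_renewalTimes_le_card_sparse_levels_succ` of `SAWBridgeZigzag` (every renewal time `r < n`
gives the singly-crossed level `y(γ_r)`, injectively), restated through the definitional identities
`renewalCount n ω = #(renewalTimes n ω)` and `levelVisits n ω h = #(levelSteps n ω h)`.
[cite: DuminilCopinHammond2013, §3, proof of Proposition 3.2 (Case 1)] -/
theorem renewalCount_le_sparseLevelCount_one_succ {n : ℕ} {ω : ℕ → Site d} (hω : ω ∈ bridges d n) :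
    renewalCount n ω ≤ sparseLevelCount 1 n ω + 1 :=
  card_renewalTimes_le_card_sparse_levels_succ hω

/-- Consequence of H1 used in Cases 1 and 3: a high bridge with at least `q + 1` renewal times, `δ₀ n ≤ q`,
lies in `SAB^{m}_{n,v,δ₀}` for every `m ≥ 1`. [cite: DuminilCopinHammond2013, §3, proof of Proposition 3.2] -/
theorem mem_sparseHighBridges_of_renewalCount {n m q : ℕ} {v δ₀ : ℝ} {ω : ℕ → Site d} (hm : 1 ≤ m)
    (hω : ω ∈ highBridges d n v) (hq : δ₀ * (n : ℝ) ≤ (q : ℝ)) (hR : q + 1 ≤ renewalCount n ω) :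
    ω ∈ sparseHighBridges d n v δ₀ m := by
  rw [mem_sparseHighBridges]
  refine ⟨hω, hq.trans ?_⟩
  have h1 := renewalCount_le_sparseLevelCount_one_succ (mem_highBridges.1 hω).1
  have h2 := sparseLevelCount_mono hm n ω
  exact_mod_cast (by omega : q ≤ sparseLevelCount m n ω)

/-! ### Z5 — entropy of "few zigzags": `Σ_{s ≤ K} C(N,s) ≤ (N/K)^K e^K` (Case 2 cost, p0009:L55–L62) -/

/-- The tail-of-binomial-row bound `Σ_{s ≤ K} C(N, s) ≤ (N/K)^K · e^K` (`1 ≤ K ≤ N`), via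
`x^K Σ_{s≤K} C(N,s) ≤ (1+x)^N ≤ e^{xN}` at `x = K/N` — the estimate "`C(m, ℓ) ≤ (m/ℓ)^ℓ e^{ℓ-1}` for
`m ≥ ℓ ≥ 2`" used in Case 2 of the printed proof, in summed form.
[cite: DuminilCopinHammond2013, §3, proof of Proposition 3.2, Case 2 (binomial estimate `binom(m, ℓ) ≤ (m/ℓ)^ℓ e^(ℓ-1)`, arXiv v1, p. 15)] -/
theorem sum_range_choose_le_div_pow_mul_exp {N K : ℕ} (hK : 0 < K) (hKN : K ≤ N) :
    (∑ s ∈ Finset.range (K + 1), (N.choose s : ℝ)) ≤ ((N : ℝ) / K) ^ K * Real.exp K := by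
  have hNpos : (0 : ℝ) < N := by exact_mod_cast hK.trans_le hKN
  have hKpos : (0 : ℝ) < K := by exact_mod_cast hK
  set x : ℝ := (K : ℝ) / N with hx
  have hx0 : 0 < x := div_pos hKpos hNpos
  have hx1 : x ≤ 1 := by rw [hx, div_le_one hNpos]; exact_mod_cast hKN
  -- `x^K Σ_{s ≤ K} C(N,s) ≤ Σ_{s ≤ N} C(N,s) x^s = (1+x)^N`
  have h1 : x ^ K * ∑ s ∈ Finset.range (K + 1), (N.choose s : ℝ) ≤
      ∑ s ∈ Finset.range (N + 1), (N.choose s : ℝ) * x ^ s := by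
    rw [Finset.mul_sum]
    calc ∑ s ∈ Finset.range (K + 1), x ^ K * (N.choose s : ℝ)
        ≤ ∑ s ∈ Finset.range (K + 1), (N.choose s : ℝ) * x ^ s := by
          refine Finset.sum_le_sum fun s hs => ?_
          rw [mul_comm]
          have hsK : s ≤ K := Nat.lt_succ_iff.1 (Finset.mem_range.1 hs)
          exact mul_le_mul_of_nonneg_left (pow_le_pow_of_le_one hx0.le hx1 hsK) (by positivity)
      _ ≤ ∑ s ∈ Finset.range (N + 1), (N.choose s : ℝ) * x ^ s := by
          refine Finset.sum_le_sum_of_subset_of_nonneg (fun s hs => Finset.mem_range.2 ((Finset.mem_range.1 hs).trans_le (Nat.succ_le_succ hKN))) ?_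
          intro s _ _; positivity
  have h2 : ∑ s ∈ Finset.range (N + 1), (N.choose s : ℝ) * x ^ s = (x + 1) ^ N := by
    rw [add_pow]
    refine Finset.sum_congr rfl fun s _ => ?_
    rw [one_pow, mul_one, mul_comm]
  have h3 : (x + 1) ^ N ≤ Real.exp K := by
    calc (x + 1) ^ N ≤ (Real.exp x) ^ N :=
          pow_le_pow_left₀ (by linarith) (Real.add_one_le_exp x) N
      _ = Real.exp K := by
          rw [← Real.exp_nat_mul, hx, mul_div_cancel₀ _ hNpos.ne']
  have hxK : 0 < x ^ K := pow_pos hx0 K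
  have : ∑ s ∈ Finset.range (K + 1), (N.choose s : ℝ) ≤ Real.exp K / x ^ K := by
    rw [le_div_iff₀ hxK, mul_comm]; linarith
  refine this.trans (le_of_eq ?_)
  have hxinv : (x ^ K)⁻¹ = ((N : ℝ) / K) ^ K := by rw [hx, ← inv_pow, inv_div]
  rw [div_eq_mul_inv, hxinv, mul_comm]

/-- Logarithmic form of the Case-2 entropy: `log Σ_{s ≤ K} C(N,s) ≤ 2√(N K) + K` for `K ≤ N` (from the
previous bound and `log y ≤ 2√y`); it is `o(N)` when `K = o(N)`, which is the printed
"`exp{-2ε_n u_n log(e/(2ε_n)) + 1}`" subexponential cost.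
[cite: DuminilCopinHammond2013, §3, proof of Proposition 3.2, Case 2 (arXiv v1, pp. 14–15)] -/
theorem log_sum_range_choose_le {N K : ℕ} (hKN : K ≤ N) :
    Real.log (∑ s ∈ Finset.range (K + 1), (N.choose s : ℝ)) ≤ 2 * Real.sqrt ((N : ℝ) * K) + K := by
  rcases Nat.eq_zero_or_pos K with rfl | hK
  · simp
  have hNpos : (0 : ℝ) < N := by exact_mod_cast hK.trans_le hKN
  have hKpos : (0 : ℝ) < K := by exact_mod_cast hK
  have hsum_pos : 0 < ∑ s ∈ Finset.range (K + 1), (N.choose s : ℝ) := by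
    refine Finset.sum_pos' (fun s _ => by positivity) ⟨0, Finset.mem_range.2 (by omega), by simp⟩
  have h1 := sum_range_choose_le_div_pow_mul_exp hK hKN
  have h2 : Real.log (∑ s ∈ Finset.range (K + 1), (N.choose s : ℝ)) ≤
      K * Real.log ((N : ℝ) / K) + K := by
    have := Real.log_le_log hsum_pos h1
    rwa [Real.log_mul (by positivity) (Real.exp_pos _).ne', Real.log_exp, Real.log_pow] at this
  -- `log (N/K) ≤ 2 √(N/K)`
  have h3 : Real.log ((N : ℝ) / K) ≤ 2 * Real.sqrt ((N : ℝ) / K) := by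
    have := Real.log_le_rpow_div (x := (N : ℝ) / K) (ε := 1 / 2) (by positivity) (by norm_num)
    rw [Real.sqrt_eq_rpow]
    linarith
  have h4 : (K : ℝ) * (2 * Real.sqrt ((N : ℝ) / K)) = 2 * Real.sqrt ((N : ℝ) * K) := by
    have hKs : (K : ℝ) = Real.sqrt K * Real.sqrt K := (Real.mul_self_sqrt hKpos.le).symm
    rw [show (N : ℝ) * K = ((N : ℝ) / K) * (K * K) by field_simp]
    rw [Real.sqrt_mul (by positivity), Real.sqrt_mul_self hKpos.le]
    ring
  calc Real.log (∑ s ∈ Finset.range (K + 1), (N.choose s : ℝ))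
      ≤ K * Real.log ((N : ℝ) / K) + K := h2
    _ ≤ K * (2 * Real.sqrt ((N : ℝ) / K)) + K := by
        have := mul_le_mul_of_nonneg_left h3 hKpos.le; linarith
    _ = 2 * Real.sqrt ((N : ℝ) * K) + K := by rw [h4]


/-- `1 ≤ Σ_{s ≤ K} C(N, s)` (the `s = 0` term). [folklore] -/
private theorem one_le_sum_range_choose (N K : ℕ) : (1 : ℝ) ≤ ∑ s ∈ Finset.range (K + 1), (N.choose s : ℝ) := by
  have h0 : (0 : ℕ) ∈ Finset.range (K + 1) := Finset.mem_range.2 (Nat.succ_pos K)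
  have := Finset.single_le_sum (f := fun s => (N.choose s : ℝ)) (fun s _ => by positivity) h0
  simpa using this

/-- Floor bookkeeping: `(1/c) · N ≤ ⌊N/c⌋ + 1`. [folklore] -/
private theorem one_div_mul_le_natDiv_succ (N : ℕ) {c : ℕ} (hc : 0 < c) :
    (1 / (c : ℝ)) * N ≤ ((N / c : ℕ) : ℝ) + 1 := by
  have hc' : (0 : ℝ) < c := by exact_mod_cast hc
  have h := Nat.lt_div_mul_add (a := N) hc
  have h' : (N : ℝ) < ((N / c : ℕ) : ℝ) * c + c := by exact_mod_cast h
  rw [div_mul_eq_mul_div, one_mul, div_le_iff₀ hc', add_mul, one_mul]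
  exact h'.le

/-! ### Z6 — Proposition 3.2 from the per-`n` counts (the three cases of the printed proof) -/

section Assembly

variable (Zc : ℕ → (ℕ → Site d) → ℕ) {v : ℝ} {k : ℕ} {δ : ℝ}

/-- A constant ratio `c ≥ 1` along a subsequence `ψ` of `u` with `u (ψ n) ≥ 1` is of the required
`e^{ε_n u(ψ n)}` form with `ε_n = log c / u(ψ n) → 0`. [folklore] -/
private theorem prop32Concl_of_const {u : ℕ → ℕ} (hu : StrictMono u) {ψ : ℕ → ℕ} (hψ : StrictMono ψ)
    {δ' : ℝ} (hδ' : 0 < δ') {c : ℝ} (hc : 1 ≤ c) (hN : ∀ n, 1 ≤ u (ψ n))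
    (h : ∀ n, ((sparseHighBridges d (u (ψ n)) v δ k).card : ℝ) ≤
      c * ((sparseHighBridges d (u (ψ n)) v δ' (k - 1)).card : ℝ)) :
    ∃ δ' : ℝ, 0 < δ' ∧ ∃ φ : ℕ → ℕ, StrictMono φ ∧ ∃ ε : ℕ → ℝ, Tendsto ε atTop (𝓝 0) ∧
      ∀ n : ℕ, ((sparseHighBridges d (u (φ n)) v δ k).card : ℝ) ≤
        Real.exp (ε n * (u (φ n) : ℝ)) * ((sparseHighBridges d (u (φ n)) v δ' (k - 1)).card : ℝ) := by
  refine ⟨δ', hδ', ψ, hψ, fun n => Real.log c / (u (ψ n) : ℝ), ?_, fun n => ?_⟩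
  · have ht : Tendsto (fun n => ((u (ψ n) : ℕ) : ℝ)) atTop atTop :=
      tendsto_natCast_atTop_atTop.comp (hu.comp hψ).tendsto_atTop
    exact tendsto_const_nhds.div_atTop ht
  · have hNpos : (0 : ℝ) < u (ψ n) := by exact_mod_cast hN n
    rw [div_mul_cancel₀ _ hNpos.ne', Real.exp_log (by linarith)]
    exact h n

/-- **Case 1 ("many renewal points")**: if, frequently along `u`, a quarter of `SAB^k_{N,v,δ}` has at least
`⌊N/c⌋ + 2` renewal times, then Prop 3.2 holds with `δ' = 1/c` (H1: those walks lie in `SAB^{k-1}_{N,v,1/c}`).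
[cite: DuminilCopinHammond2013, §3, proof of Proposition 3.2, Case 1] -/
private theorem prop32Concl_case1 (hk : 2 ≤ k) {u : ℕ → ℕ} (hu : StrictMono u) {c : ℕ} (hc : 0 < c)
    (hC1 : ∃ᶠ n in atTop, (sparseHighBridges d (u n) v δ k).card ≤
      4 * ((sparseHighBridges d (u n) v δ k).filter fun γ => u n / c + 2 ≤ renewalCount (u n) γ).card) :
    ∃ δ' : ℝ, 0 < δ' ∧ ∃ φ : ℕ → ℕ, StrictMono φ ∧ ∃ ε : ℕ → ℝ, Tendsto ε atTop (𝓝 0) ∧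
      ∀ n : ℕ, ((sparseHighBridges d (u (φ n)) v δ k).card : ℝ) ≤
        Real.exp (ε n * (u (φ n) : ℝ)) * ((sparseHighBridges d (u (φ n)) v δ' (k - 1)).card : ℝ) := by
  obtain ⟨ψ, hψ, hP⟩ := Filter.extraction_of_frequently_atTop
    (hC1.and_eventually (hu.tendsto_atTop.eventually_ge_atTop 1))
  refine prop32Concl_of_const (c := 4) hu hψ (δ' := 1 / c) (by positivity) (by norm_num) (fun n => (hP n).2)
    fun n => ?_
  obtain ⟨hle, -⟩ := hP n
  set N := u (ψ n) with hNdef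
  have hsub : ((sparseHighBridges d N v δ k).filter fun γ => N / c + 2 ≤ renewalCount N γ) ⊆
      sparseHighBridges d N v (1 / c) (k - 1) := by
    intro γ hγ
    rw [Finset.mem_filter] at hγ
    exact mem_sparseHighBridges_of_renewalCount (q := N / c + 1) (by omega) (mem_sparseHighBridges.1 hγ.1).1
      (by exact_mod_cast one_div_mul_le_natDiv_succ N hc) (by omega)
  calc ((sparseHighBridges d N v δ k).card : ℝ)
      ≤ 4 * (((sparseHighBridges d N v δ k).filter fun γ => N / c + 2 ≤ renewalCount N γ).card : ℝ) := by
        exact_mod_cast hle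
    _ ≤ 4 * ((sparseHighBridges d N v (1 / c) (k - 1)).card : ℝ) :=
        mul_le_mul_of_nonneg_left (by exact_mod_cast Finset.card_le_card hsub) (by norm_num)

/-- **Case 2 ("few zigzags")**: if for every `m`, frequently along `u`, a quarter of `SAB^k_{N,v,δ}` has zigzag
statistic `≤ N/(m+1)`, then Prop 3.2 holds with `δ' = δ`: along the diagonal subsequence the H2 cost
`4 Σ_{s ≤ 2⌊N/(m+1)⌋} C(N+1,s)` is `e^{o(N)}`. [cite: DuminilCopinHammond2013, §3, proof of Proposition 3.2, Case 2] -/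
private theorem prop32Concl_case2 (hδ : 0 < δ) {u : ℕ → ℕ} (hu : StrictMono u)
    (H2 : ∀ n m : ℕ, ((sparseHighBridges d n v δ k).filter (fun γ => Zc n γ ≤ m)).card ≤
      (∑ s ∈ Finset.range (2 * m + 1), (n + 1).choose s) * (sparseHighBridges d n v δ (k - 1)).card)
    (hC2 : ∀ m : ℕ, ∃ᶠ n in atTop, (sparseHighBridges d (u n) v δ k).card ≤
      4 * ((sparseHighBridges d (u n) v δ k).filter fun γ => Zc (u n) γ ≤ u n / (m + 1)).card) :
    ∃ δ' : ℝ, 0 < δ' ∧ ∃ φ : ℕ → ℕ, StrictMono φ ∧ ∃ ε : ℕ → ℝ, Tendsto ε atTop (𝓝 0) ∧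
      ∀ n : ℕ, ((sparseHighBridges d (u (φ n)) v δ k).card : ℝ) ≤
        Real.exp (ε n * (u (φ n) : ℝ)) * ((sparseHighBridges d (u (φ n)) v δ' (k - 1)).card : ℝ) := by
  have hP : ∀ m, ∃ᶠ n in atTop, (sparseHighBridges d (u n) v δ k).card ≤
      4 * ((sparseHighBridges d (u n) v δ k).filter fun γ => Zc (u n) γ ≤ u n / (m + 1)).card ∧ m + 1 ≤ u n :=
    fun m => (hC2 m).and_eventually (hu.tendsto_atTop.eventually_ge_atTop (m + 1))
  obtain ⟨ψ, hψ, hPψ⟩ := Filter.extraction_forall_of_frequently hP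
  -- the cost sequence
  set B : ℕ → ℝ := fun n =>
    4 * ∑ s ∈ Finset.range (2 * (u (ψ n) / (n + 1)) + 1), ((u (ψ n) + 1).choose s : ℝ) with hB
  have hB1 : ∀ n, 1 ≤ B n := fun n => by
    have := one_le_sum_range_choose (u (ψ n) + 1) (2 * (u (ψ n) / (n + 1)))
    simp only [hB]; linarith
  have hNpos : ∀ n, (0 : ℝ) < u (ψ n) := fun n => by
    have := (hPψ n).2; exact_mod_cast (by omega : 0 < u (ψ n))
  refine ⟨δ, hδ, ψ, hψ, fun n => Real.log (B n) / (u (ψ n) : ℝ), ?_, fun n => ?_⟩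
  · -- `ε_n → 0`: `0 ≤ ε_n ≤ log 4/(n+1) + 4 √(1/(n+1)) + 2/(n+1)` for `n ≥ 1`
    have hg : Tendsto (fun n : ℕ => Real.log 4 / ((n : ℝ) + 1) + 4 * Real.sqrt (1 / ((n : ℝ) + 1)) +
        2 / ((n : ℝ) + 1)) atTop (𝓝 0) := by
      have h1 : Tendsto (fun n : ℕ => 1 / ((n : ℝ) + 1)) atTop (𝓝 0) := tendsto_one_div_add_atTop_nhds_zero_nat
      have h2 : Tendsto (fun n : ℕ => Real.log 4 / ((n : ℝ) + 1)) atTop (𝓝 0) := by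
        simpa [div_eq_mul_inv] using h1.const_mul (Real.log 4)
      have h3 : Tendsto (fun n : ℕ => 4 * Real.sqrt (1 / ((n : ℝ) + 1))) atTop (𝓝 0) := by
        simpa using (h1.sqrt).const_mul 4
      have h4 : Tendsto (fun n : ℕ => 2 / ((n : ℝ) + 1)) atTop (𝓝 0) := by
        simpa [div_eq_mul_inv] using h1.const_mul 2
      simpa using (h2.add h3).add h4
    refine tendsto_of_tendsto_of_tendsto_of_le_of_le' tendsto_const_nhds hg ?_ ?_
    · exact Eventually.of_forall fun n => div_nonneg (Real.log_nonneg (hB1 n)) (hNpos n).le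
    · filter_upwards [Filter.eventually_ge_atTop 1] with n hn
      obtain ⟨-, hNn⟩ := hPψ n
      set N := u (ψ n) with hNdef
      set K := 2 * (N / (n + 1)) with hKdef
      have hNpos' := hNpos n
      have hN1 : (1 : ℝ) ≤ N := by exact_mod_cast (by omega : 1 ≤ N)
      have hn1 : (0 : ℝ) < (n : ℝ) + 1 := by positivity
      -- `K ≤ 2N/(n+1)` and `K ≤ N + 1`
      have hdiv : ((N / (n + 1) : ℕ) : ℝ) ≤ (N : ℝ) / ((n : ℝ) + 1) := by
        rw [le_div_iff₀ hn1]; exact_mod_cast Nat.div_mul_le_self N (n + 1)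
      have hKle : (K : ℝ) ≤ 2 * N / ((n : ℝ) + 1) := by
        have hK' : (K : ℝ) = 2 * ((N / (n + 1) : ℕ) : ℝ) := by simp only [hKdef]; push_cast; ring
        rw [hK', mul_div_assoc]; exact mul_le_mul_of_nonneg_left hdiv (by norm_num)
      have hKN : K ≤ N + 1 := by
        have : N / (n + 1) ≤ N / 2 := Nat.div_le_div_left (by omega) (by omega)
        omega
      have hlog : Real.log (B n) ≤ Real.log 4 + (2 * Real.sqrt (((N + 1 : ℕ) : ℝ) * K) + K) := by
        simp only [hB]
        rw [Real.log_mul (by norm_num) (by linarith [one_le_sum_range_choose (N + 1) K])]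
        exact add_le_add le_rfl (log_sum_range_choose_le hKN)
      -- `2 √((N+1) K) ≤ 4 N √(1/(n+1))`
      have hsq : 2 * Real.sqrt (((N + 1 : ℕ) : ℝ) * K) ≤ 4 * N * Real.sqrt (1 / ((n : ℝ) + 1)) := by
        have hle : ((N + 1 : ℕ) : ℝ) * K ≤ (2 * N) ^ 2 * (1 / ((n : ℝ) + 1)) := by
          push_cast
          have hN2 : (N : ℝ) + 1 ≤ 2 * N := by linarith
          calc ((N : ℝ) + 1) * K ≤ (2 * N) * (2 * N / ((n : ℝ) + 1)) :=
                mul_le_mul hN2 hKle (by positivity) (by positivity)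
            _ = (2 * N) ^ 2 * (1 / ((n : ℝ) + 1)) := by ring
        calc 2 * Real.sqrt (((N + 1 : ℕ) : ℝ) * K) ≤ 2 * Real.sqrt ((2 * N) ^ 2 * (1 / ((n : ℝ) + 1))) := by
              gcongr
          _ = 4 * N * Real.sqrt (1 / ((n : ℝ) + 1)) := by
              rw [Real.sqrt_mul (by positivity), Real.sqrt_sq (by positivity)]; ring
      -- assemble
      rw [div_le_iff₀ hNpos']
      have hK2 : (K : ℝ) ≤ 2 / ((n : ℝ) + 1) * N := by rw [div_mul_eq_mul_div]; exact hKle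
      have hl4 : Real.log 4 ≤ Real.log 4 / ((n : ℝ) + 1) * N := by
        rw [div_mul_eq_mul_div, le_div_iff₀ hn1]
        have : (n : ℝ) + 1 ≤ N := by exact_mod_cast hNn
        exact mul_le_mul_of_nonneg_left this (Real.log_nonneg (by norm_num))
      nlinarith [hlog, hsq, hK2, hl4, Real.sqrt_nonneg (1 / ((n : ℝ) + 1)), hNpos']
  · obtain ⟨hle, hNn⟩ := hPψ n
    set N := u (ψ n) with hNdef
    rw [div_mul_cancel₀ _ (hNpos n).ne', Real.exp_log (by linarith [hB1 n])]
    have h2 := H2 N (N / (n + 1))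
    calc ((sparseHighBridges d N v δ k).card : ℝ)
        ≤ 4 * (((sparseHighBridges d N v δ k).filter fun γ => Zc N γ ≤ N / (n + 1)).card : ℝ) := by
          exact_mod_cast hle
      _ ≤ 4 * ((∑ s ∈ Finset.range (2 * (N / (n + 1)) + 1), ((N + 1).choose s : ℝ)) *
            ((sparseHighBridges d N v δ (k - 1)).card : ℝ)) :=
          mul_le_mul_of_nonneg_left (by exact_mod_cast h2) (by norm_num)
      _ = B n * ((sparseHighBridges d N v δ (k - 1)).card : ℝ) := by simp only [hB]; ring

/-- The ARITHMETIC of Case 3 (thresholds `L = 2m₀+1`, `c₁ = 8(L+1)(m₀+1)`, `c₂ = 32L(L+1)(m₀+1)`,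
`q = ⌊N/(m₀+1)⌋`, `a = q + 1 - ⌊q/2⌋`, `t = ⌊N/c₂⌋ + 2`, `r = ⌊N/c₁⌋ + 1`): for `N ≥ 22(m₀+1)(4 + 14L + 12L²)` one
has `a - t ≥ 2(L+1)(r + 3Lt)`, hence `t ≤ (r+3Lt)L ≤ a` and, by Lemma 3.8, `2^t · C((r+3Lt)L, t) ≤ C(a, t)`.
[cite: DuminilCopinHammond2013, §3, proof of Proposition 3.2, Case 3 (choice of δ'') and Lemma 3.8] -/
private theorem case3_arith {m₀ N L c₁ c₂ q a t r : ℕ} (hL : L = 2 * m₀ + 1)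
    (hc₁ : c₁ = 8 * (2 * m₀ + 2) * (m₀ + 1)) (hc₂ : c₂ = 32 * (2 * m₀ + 1) * (2 * m₀ + 2) * (m₀ + 1))
    (hqdef : q = N / (m₀ + 1)) (hadef : a = q + 1 - q / 2) (htdef : t = N / c₂ + 2) (hrdef : r = N / c₁ + 1)
    (hNbn : 22 * (m₀ + 1) * (4 + 14 * L + 12 * L ^ 2) ≤ N) :
    t ≤ (r + 3 * L * t) * L ∧
      (2 : ℝ) ^ t * ((((r + 3 * L * t) * L).choose t : ℕ) : ℝ) ≤ ((a.choose t : ℕ) : ℝ) := by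
  have hM : (0 : ℝ) < (m₀ : ℝ) + 1 := by positivity
  set X : ℝ := (N : ℝ) / ((m₀ : ℝ) + 1) with hXdef
  have hX0 : 0 ≤ X := by positivity
  have hL1 : 1 ≤ L := by omega
  have hLr : (1 : ℝ) ≤ L := by exact_mod_cast hL1
  have hc₁r : (c₁ : ℝ) = 8 * ((L : ℝ) + 1) * ((m₀ : ℝ) + 1) := by
    rw [hc₁, hL]; simp only [Nat.cast_mul, Nat.cast_add, Nat.cast_ofNat, Nat.cast_one]; ring
  have hc₂r : (c₂ : ℝ) = 32 * L * ((L : ℝ) + 1) * ((m₀ : ℝ) + 1) := by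
    rw [hc₂, hL]; simp only [Nat.cast_mul, Nat.cast_add, Nat.cast_ofNat, Nat.cast_one]; ring
  have hc₂pos : (0 : ℝ) < c₂ := by rw [hc₂r]; positivity
  have hc₁pos : (0 : ℝ) < c₁ := by rw [hc₁r]; positivity
  -- `f1`: `a ≥ X/2 + 1/2`
  have f1 : X / 2 + 1 / 2 ≤ (a : ℝ) := by
    have hqX : X < (q : ℝ) + 1 := by
      rw [hXdef, div_lt_iff₀ hM]
      have := Nat.lt_div_mul_add (a := N) (show 0 < m₀ + 1 by omega)
      have h' : (N : ℝ) < ((N / (m₀ + 1) : ℕ) : ℝ) * (((m₀ + 1 : ℕ) : ℝ)) + ((m₀ + 1 : ℕ) : ℝ) := by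
        exact_mod_cast this
      rw [Nat.cast_add, Nat.cast_one, ← hqdef] at h'
      linarith
    have hq2r : ((q / 2 : ℕ) : ℝ) * 2 ≤ (q : ℝ) := by exact_mod_cast Nat.div_mul_le_self q 2
    have har : (a : ℝ) = (q : ℝ) + 1 - ((q / 2 : ℕ) : ℝ) := by
      have hle : q / 2 ≤ q + 1 := by omega
      rw [hadef, Nat.cast_sub hle, Nat.cast_add, Nat.cast_one]
    rw [har]; linarith
  -- `f2`: `t ≤ X/64 + 2`
  have hdiv₂ : ((N / c₂ : ℕ) : ℝ) ≤ (N : ℝ) / c₂ := Nat.cast_div_le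
  have hdiv₁ : ((N / c₁ : ℕ) : ℝ) ≤ (N : ℝ) / c₁ := Nat.cast_div_le
  have ht' : (t : ℝ) = ((N / c₂ : ℕ) : ℝ) + 2 := by rw [htdef, Nat.cast_add, Nat.cast_ofNat]
  have hr' : (r : ℝ) = ((N / c₁ : ℕ) : ℝ) + 1 := by rw [hrdef, Nat.cast_add, Nat.cast_one]
  have f2 : (t : ℝ) ≤ X / 64 + 2 := by
    have h2 : (N : ℝ) / c₂ ≤ (N : ℝ) / (64 * ((m₀ : ℝ) + 1)) := by
      apply div_le_div_of_nonneg_left (by positivity) (by positivity)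
      rw [hc₂r]
      have h64 : (64 : ℝ) ≤ 32 * L * ((L : ℝ) + 1) := by nlinarith
      exact mul_le_mul_of_nonneg_right h64 hM.le
    have h3 : (N : ℝ) / (64 * ((m₀ : ℝ) + 1)) = X / 64 := by rw [hXdef, div_div, mul_comm]
    linarith
  -- `f3`: `2(L+1) r ≤ X/4 + 2(L+1)`
  have f3 : 2 * ((L : ℝ) + 1) * r ≤ X / 4 + 2 * ((L : ℝ) + 1) := by
    have h2 : 2 * ((L : ℝ) + 1) * ((N : ℝ) / c₁) = X / 4 := by
      rw [hc₁r, hXdef]; field_simp; ring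
    have hL0 : (0 : ℝ) ≤ 2 * ((L : ℝ) + 1) := by positivity
    have := mul_le_mul_of_nonneg_left hdiv₁ hL0
    rw [hr']; linarith
  -- `f4`: `6L(L+1) t ≤ 3X/16 + 12L(L+1)`
  have f4 : 6 * L * ((L : ℝ) + 1) * t ≤ 3 * X / 16 + 12 * L * ((L : ℝ) + 1) := by
    have h2 : 6 * L * ((L : ℝ) + 1) * ((N : ℝ) / c₂) = 3 * X / 16 := by
      rw [hc₂r, hXdef]; field_simp; ring
    have hL0 : (0 : ℝ) ≤ 6 * L * ((L : ℝ) + 1) := by positivity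
    have := mul_le_mul_of_nonneg_left hdiv₂ hL0
    rw [ht']; linarith
  -- `f5`: `X ≥ 22(4 + 14L + 12L²)`
  have f5 : 22 * (4 + 14 * L + 12 * (L : ℝ) ^ 2) ≤ X := by
    rw [hXdef, le_div_iff₀ hM]
    have : ((22 * (m₀ + 1) * (4 + 14 * L + 12 * L ^ 2) : ℕ) : ℝ) ≤ N := by exact_mod_cast hNbn
    simp only [Nat.cast_mul, Nat.cast_add, Nat.cast_ofNat, Nat.cast_one, Nat.cast_pow] at this
    linarith
  have key : 2 * ((L : ℝ) + 1) * ((r : ℝ) + 3 * L * t) ≤ (a : ℝ) - t := by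
    have hL0 : (0 : ℝ) ≤ L := by positivity
    have hL2 : (0 : ℝ) ≤ (L : ℝ) ^ 2 := by positivity
    linarith
  -- Lemma 3.8 with `n₂ = (r + 3Lt)L`
  have htn2 : t ≤ (r + 3 * L * t) * L :=
    calc t ≤ 3 * L * t := Nat.le_mul_of_pos_left t (by omega)
      _ ≤ r + 3 * L * t := Nat.le_add_left _ _
      _ ≤ (r + 3 * L * t) * L := Nat.le_mul_of_pos_right _ (by omega)
  have hrt0 : (0 : ℝ) ≤ (r : ℝ) + 3 * L * t := by positivity
  have hn2key : 2 * (((r : ℝ) + 3 * L * t) * L) ≤ (a : ℝ) - t := by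
    have h0 : ((r : ℝ) + 3 * L * t) * L ≤ ((L : ℝ) + 1) * ((r : ℝ) + 3 * L * t) := by nlinarith
    linarith
  have hcast0 : (((r + 3 * L * t) * L : ℕ) : ℝ) = ((r : ℝ) + 3 * L * t) * L := by
    simp only [Nat.cast_mul, Nat.cast_add, Nat.cast_ofNat]
  have hn2a : (r + 3 * L * t) * L ≤ a := by
    have h2 : (0 : ℝ) ≤ t := by positivity
    have h3 : (0 : ℝ) ≤ ((r : ℝ) + 3 * L * t) * L := by positivity
    have : (((r + 3 * L * t) * L : ℕ) : ℝ) ≤ (a : ℝ) := by rw [hcast0]; linarith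
    exact_mod_cast this
  have h38 := Literature.Combinatorics.DuminilCopinHammond2013_lemma38 hn2a htn2
  have ht2 : 2 ≤ t := by rw [htdef]; exact Nat.le_add_left 2 _
  have hn2pos : (0 : ℝ) < (((r + 3 * L * t) * L : ℕ) : ℝ) := by
    exact_mod_cast (lt_of_lt_of_le (by omega : 0 < t) htn2)
  have hratio : (2 : ℝ) ≤ ((a : ℝ) - t) / (((r + 3 * L * t) * L : ℕ) : ℝ) := by
    rw [le_div_iff₀ hn2pos, hcast0]; linarith
  have hpow : (2 : ℝ) ^ t ≤ (a.choose t : ℝ) / (((r + 3 * L * t) * L).choose t : ℝ) :=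
    (pow_le_pow_left₀ (by norm_num) hratio t).trans h38
  have hCpos : (0 : ℝ) < (((r + 3 * L * t) * L).choose t : ℝ) := by exact_mod_cast Nat.choose_pos htn2
  exact ⟨htn2, by rwa [le_div_iff₀ hCpos] at hpow⟩

/-- Case 3 at ONE length `N ≥ 22(m₀+1)(4 + 14L + 12L²)`: if fewer than a quarter of `S = SAB^k_{N,v,δ}` has
`Zc ≤ ⌊N/(m₀+1)⌋` and fewer than a quarter has `≥ ⌊N/c₁⌋ + 2` renewal times, then at least half of `S` has
`≥ a + ⌊N/(L+1)⌋` non-degenerate zigzags and `≤ r` renewal times, and H3 (with `t = ⌊N/c₂⌋ + 2`) together with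
`case3_arith` and H1 gives `#S ≤ 2 · #SAB^{k-1}_{N,v,1/c₂}`.
[cite: DuminilCopinHammond2013, §3, proof of Proposition 3.2, Case 3] -/
private theorem case3_step (hk : 2 ≤ k) (m₀ : ℕ) {N : ℕ}
    (hNbn : 22 * (m₀ + 1) * (4 + 14 * (2 * m₀ + 1) + 12 * (2 * m₀ + 1) ^ 2) ≤ N)
    (H3N : ∀ L t a r : ℕ, 1 ≤ L →
      ((sparseHighBridges d N v δ k).filter
          (fun γ => a + N / (L + 1) ≤ Zc N γ ∧ renewalCount N γ ≤ r)).card * a.choose t ≤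
        ((r + 3 * L * t) * L).choose t * ((highBridges d N v).filter (fun φ => t ≤ renewalCount N φ)).card)
    (hGn : 4 * ((sparseHighBridges d N v δ k).filter fun γ => Zc N γ ≤ N / (m₀ + 1)).card <
      (sparseHighBridges d N v δ k).card)
    (hFn : 4 * ((sparseHighBridges d N v δ k).filter
        fun γ => N / (8 * (2 * m₀ + 2) * (m₀ + 1)) + 2 ≤ renewalCount N γ).card <
      (sparseHighBridges d N v δ k).card) :
    ((sparseHighBridges d N v δ k).card : ℝ) ≤
      2 * ((sparseHighBridges d N v (1 / ((32 * (2 * m₀ + 1) * (2 * m₀ + 2) * (m₀ + 1) : ℕ) : ℝ))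
        (k - 1)).card : ℝ) := by
  set L : ℕ := 2 * m₀ + 1 with hL
  set c₁ : ℕ := 8 * (2 * m₀ + 2) * (m₀ + 1) with hc₁
  set c₂ : ℕ := 32 * (2 * m₀ + 1) * (2 * m₀ + 2) * (m₀ + 1) with hc₂
  have hc₂pos : 0 < c₂ := by positivity
  set q := N / (m₀ + 1) with hqdef
  set a := q + 1 - q / 2 with hadef
  set t := N / c₂ + 2 with htdef
  set r := N / c₁ + 1 with hrdef
  set S := sparseHighBridges d N v δ k with hSdef
  set A' := S.filter (fun γ => ¬ (Zc N γ ≤ q) ∧ ¬ (N / c₁ + 2 ≤ renewalCount N γ)) with hA'def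
  set A := S.filter (fun γ => a + N / (L + 1) ≤ Zc N γ ∧ renewalCount N γ ≤ r) with hAdef
  set B := (highBridges d N v).filter (fun φ => t ≤ renewalCount N φ) with hBdef
  obtain ⟨htn2, hpow'⟩ := case3_arith (N := N) hL hc₁ hc₂ hqdef hadef htdef hrdef hNbn
  clear_value q a t r
  -- (i) counting: at least half of `S` lies in `A'`
  have hcount : S.card ≤ 2 * A'.card := by
    classical
    have h1 : S.card ≤ (S.filter fun γ => Zc N γ ≤ q).card +
        ((S.filter fun γ => N / c₁ + 2 ≤ renewalCount N γ).card + A'.card) := by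
      calc S.card ≤ ((S.filter fun γ => Zc N γ ≤ q) ∪
            ((S.filter fun γ => N / c₁ + 2 ≤ renewalCount N γ) ∪ A')).card := by
            refine Finset.card_le_card fun γ hγ => ?_
            simp only [Finset.mem_union, Finset.mem_filter, hA'def]
            by_cases h1 : Zc N γ ≤ q
            · exact Or.inl ⟨hγ, h1⟩
            by_cases h2 : N / c₁ + 2 ≤ renewalCount N γ
            · exact Or.inr (Or.inl ⟨hγ, h2⟩)
            · exact Or.inr (Or.inr ⟨hγ, h1, h2⟩)
        _ ≤ _ := (Finset.card_union_le _ _).trans (add_le_add le_rfl (Finset.card_union_le _ _))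
    omega
  -- (ii) `A' ⊆ A` (the thresholds were chosen for this)
  have hq2 : N / (L + 1) = q / 2 := by
    rw [hqdef, Nat.div_div_eq_div_mul]
    congr 1; simp only [hL]; ring
  have haq : a + q / 2 = q + 1 := by subst hadef; omega
  have hA'A : A' ⊆ A := by
    intro γ hγ
    rw [hA'def, Finset.mem_filter, not_le, not_le] at hγ
    rw [hAdef, Finset.mem_filter, hq2, haq]
    exact ⟨hγ.1, by omega, by omega⟩
  -- (iii) `B ⊆ SAB^{k-1}_{N,v,1/c₂}` (H1)
  have hBS : B ⊆ sparseHighBridges d N v (1 / c₂) (k - 1) := by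
    intro φ hφ
    rw [hBdef, Finset.mem_filter] at hφ
    exact mem_sparseHighBridges_of_renewalCount (q := N / c₂ + 1) (by omega) hφ.1
      (by exact_mod_cast one_div_mul_le_natDiv_succ N hc₂pos) (by omega)
  -- (iv) H3 and the arithmetic: `#A ≤ #B`
  have hCpos : (0 : ℝ) < (((r + 3 * L * t) * L).choose t : ℝ) := by exact_mod_cast Nat.choose_pos htn2
  have h3 : (A.card : ℝ) * (a.choose t : ℝ) ≤ (((r + 3 * L * t) * L).choose t : ℝ) * (B.card : ℝ) := by
    have h3nat : A.card * a.choose t ≤ ((r + 3 * L * t) * L).choose t * B.card := H3N L t a r (by omega)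
    exact_mod_cast h3nat
  have hAB : (A.card : ℝ) ≤ B.card := by
    have h4 : (A.card : ℝ) * 2 ^ t * (((r + 3 * L * t) * L).choose t : ℝ) ≤
        (B.card : ℝ) * (((r + 3 * L * t) * L).choose t : ℝ) := by
      calc (A.card : ℝ) * 2 ^ t * (((r + 3 * L * t) * L).choose t : ℝ)
          = (A.card : ℝ) * (2 ^ t * (((r + 3 * L * t) * L).choose t : ℝ)) := by ring
        _ ≤ (A.card : ℝ) * (a.choose t : ℝ) := mul_le_mul_of_nonneg_left hpow' (Nat.cast_nonneg _)
        _ ≤ (((r + 3 * L * t) * L).choose t : ℝ) * (B.card : ℝ) := h3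
        _ = (B.card : ℝ) * (((r + 3 * L * t) * L).choose t : ℝ) := by ring
    have h5 : (A.card : ℝ) * 2 ^ t ≤ B.card := le_of_mul_le_mul_right h4 hCpos
    exact le_trans (le_mul_of_one_le_right (Nat.cast_nonneg _) (one_le_pow₀ (by norm_num))) h5
  -- (v) conclusion
  have hA'B : (A'.card : ℝ) ≤ B.card := le_trans (by exact_mod_cast Finset.card_le_card hA'A) hAB
  have hBS' : (B.card : ℝ) ≤ (sparseHighBridges d N v (1 / c₂) (k - 1)).card := by
    exact_mod_cast Finset.card_le_card hBS
  have hcount' : (S.card : ℝ) ≤ 2 * A'.card := by exact_mod_cast hcount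
  linarith

/-- **Case 3 ("many zigzags and few renewal points")**: if eventually along `u` fewer than a quarter of
`SAB^k_{N,v,δ}` has zigzag statistic `≤ N/(m₀+1)` and fewer than a quarter has `≥ ⌊N/c₁⌋ + 2` renewal times
(`c₁ = 8(L+1)(m₀+1)`, `L = 2m₀+1`), then Prop 3.2 holds with ratio `2` and `δ' = 1/c₂`, `c₂ = 32L(L+1)(m₀+1)`
(`case3_step` at every large `N = u n`). [cite: DuminilCopinHammond2013, §3, proof of Proposition 3.2, Case 3] -/
private theorem prop32Concl_case3 (hk : 2 ≤ k) {u : ℕ → ℕ} (hu : StrictMono u)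
    (H3 : ∀ n L t a r : ℕ, 1 ≤ L →
      ((sparseHighBridges d n v δ k).filter
          (fun γ => a + n / (L + 1) ≤ Zc n γ ∧ renewalCount n γ ≤ r)).card * a.choose t ≤
        ((r + 3 * L * t) * L).choose t * ((highBridges d n v).filter (fun φ => t ≤ renewalCount n φ)).card)
    (m₀ : ℕ)
    (hG : ∀ᶠ n in atTop, 4 * ((sparseHighBridges d (u n) v δ k).filter
        fun γ => Zc (u n) γ ≤ u n / (m₀ + 1)).card < (sparseHighBridges d (u n) v δ k).card)
    (hF : ∀ᶠ n in atTop, 4 * ((sparseHighBridges d (u n) v δ k).filter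
        fun γ => u n / (8 * (2 * m₀ + 2) * (m₀ + 1)) + 2 ≤ renewalCount (u n) γ).card <
        (sparseHighBridges d (u n) v δ k).card) :
    ∃ δ' : ℝ, 0 < δ' ∧ ∃ φ : ℕ → ℕ, StrictMono φ ∧ ∃ ε : ℕ → ℝ, Tendsto ε atTop (𝓝 0) ∧
      ∀ n : ℕ, ((sparseHighBridges d (u (φ n)) v δ k).card : ℝ) ≤
        Real.exp (ε n * (u (φ n) : ℝ)) * ((sparseHighBridges d (u (φ n)) v δ' (k - 1)).card : ℝ) := by
  set Nb : ℕ := 22 * (m₀ + 1) * (4 + 14 * (2 * m₀ + 1) + 12 * (2 * m₀ + 1) ^ 2) with hNb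
  have hlarge : ∀ᶠ n in atTop, Nb ≤ u n := hu.tendsto_atTop.eventually_ge_atTop Nb
  obtain ⟨n₀, hn₀⟩ := Filter.eventually_atTop.1 (hG.and (hF.and hlarge))
  have hψ : StrictMono fun n => n + n₀ := fun a b hab => by dsimp; omega
  have hNb1 : 1 ≤ Nb := by
    have : 1 ≤ 4 + 14 * (2 * m₀ + 1) + 12 * (2 * m₀ + 1) ^ 2 := by omega
    calc 1 = 1 * 1 * 1 := by norm_num
      _ ≤ 22 * (m₀ + 1) * (4 + 14 * (2 * m₀ + 1) + 12 * (2 * m₀ + 1) ^ 2) := by gcongr <;> omega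
  have hc₂pos : 0 < (32 * (2 * m₀ + 1) * (2 * m₀ + 2) * (m₀ + 1) : ℕ) := by positivity
  refine prop32Concl_of_const (c := 2) hu hψ
    (δ' := 1 / ((32 * (2 * m₀ + 1) * (2 * m₀ + 2) * (m₀ + 1) : ℕ) : ℝ)) (by positivity) (by norm_num)
    (fun n => hNb1.trans (hn₀ (n + n₀) (by omega)).2.2) fun n => ?_
  obtain ⟨hGn, hFn, hNbn⟩ := hn₀ (n + n₀) (by omega)
  exact case3_step Zc hk m₀ hNbn (fun L t a r hL => H3 (u (n + n₀)) L t a r hL) hGn hFn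

/-- **K1-Z5/Z6 (per dimension): Proposition 3.2 of Duminil-Copin–Hammond 2013 from the per-`n` counts.**
For fixed `d, v, k ≥ 2, δ > 0`, given an arbitrary "zigzag statistic" `Zc n γ : ℕ` and
* **H2** (Case 2 — unfold ALL zigzags; the injection `γ ↦ (Unf_{Z_γ} γ, zig/zag index set)`):
  `#{γ ∈ SAB^k_{n,v,δ} : Zc γ ≤ m} ≤ (Σ_{s ≤ 2m} C(n+1, s)) · #SAB^{k-1}_{n,v,δ}`;
* **H3** (Case 3 — the multi-valued map unfolding `t` of `≥ a` non-degenerate short (central length `≤ L`) zigzags,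
  `Z ↦ Unf_Z γ` injective, each image a high bridge with `≥ t` renewal times, multiplicity
  `≤ C((r + 3Lt)·L, t)` when `|R_γ| ≤ r`, since each unfolding creates `≤ 3L` renewal points and the unfolded
  set `Z` is a `t`-subset of the `≤ |R_φ|·L` pairs `(i, j)` with `i` a renewal time of the image and `0 < j-i ≤ L`):
  `#{γ ∈ SAB^k_{n,v,δ} : a + ⌊n/(L+1)⌋ ≤ Zc γ ∧ |R_γ| ≤ r} · C(a,t) ≤ C((r+3Lt)L, t) · #{φ ∈ SAB_{n,v} : t ≤ |R_φ|}`,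
for every subsequence `u` there are `δ' > 0`, a further subsequence `u ∘ φ` and `ε_n → 0` with
`#SAB^k_{u(φ n),v,δ} ≤ e^{ε_n u(φ n)} #SAB^{k-1}_{u(φ n),v,δ'}`. The proof is the printed trichotomy (Case 1 via
H1 `renewalCount_le_sparseLevelCount_one_succ`, Case 2 via H2 and the entropy bound
`log Σ_{s≤K} C(N,s) ≤ 2√(NK) + K` along the diagonal subsequence `Filter.extraction_forall_of_frequently`,
Case 3 via H3 and Lemma 3.8 with the fixed thresholds `L = 2m₀+1`, `c₁ = 8(L+1)(m₀+1)`, `c₂ = 32L(L+1)(m₀+1)`),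
`δ' ∈ {1/c₁, δ, 1/c₂}`. [cite: DuminilCopinHammond2013, Proposition 3.2 and its proof, §3 (arXiv v1, pp. 11, 13–17)] -/
theorem dch_prop32At_of_counts (hk : 2 ≤ k) (hδ : 0 < δ)
    (H2 : ∀ n m : ℕ, ((sparseHighBridges d n v δ k).filter (fun γ => Zc n γ ≤ m)).card ≤
      (∑ s ∈ Finset.range (2 * m + 1), (n + 1).choose s) * (sparseHighBridges d n v δ (k - 1)).card)
    (H3 : ∀ n L t a r : ℕ, 1 ≤ L →
      ((sparseHighBridges d n v δ k).filter
          (fun γ => a + n / (L + 1) ≤ Zc n γ ∧ renewalCount n γ ≤ r)).card * a.choose t ≤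
        ((r + 3 * L * t) * L).choose t * ((highBridges d n v).filter (fun φ => t ≤ renewalCount n φ)).card)
    (u : ℕ → ℕ) (hu : StrictMono u) :
    ∃ δ' : ℝ, 0 < δ' ∧ ∃ φ : ℕ → ℕ, StrictMono φ ∧ ∃ ε : ℕ → ℝ, Tendsto ε atTop (𝓝 0) ∧
      ∀ n : ℕ, ((sparseHighBridges d (u (φ n)) v δ k).card : ℝ) ≤
        Real.exp (ε n * (u (φ n) : ℝ)) * ((sparseHighBridges d (u (φ n)) v δ' (k - 1)).card : ℝ) := by
  by_cases hC2 : ∀ m : ℕ, ∃ᶠ n in atTop, (sparseHighBridges d (u n) v δ k).card ≤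
      4 * ((sparseHighBridges d (u n) v δ k).filter fun γ => Zc (u n) γ ≤ u n / (m + 1)).card
  · exact prop32Concl_case2 Zc hδ hu H2 hC2
  · rw [not_forall] at hC2
    obtain ⟨m₀, hm₀⟩ := hC2
    have hG : ∀ᶠ n in atTop, 4 * ((sparseHighBridges d (u n) v δ k).filter
        fun γ => Zc (u n) γ ≤ u n / (m₀ + 1)).card < (sparseHighBridges d (u n) v δ k).card := by
      simpa [Filter.not_frequently, not_le] using hm₀
    by_cases hC1 : ∃ᶠ n in atTop, (sparseHighBridges d (u n) v δ k).card ≤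
        4 * ((sparseHighBridges d (u n) v δ k).filter
          fun γ => u n / (8 * (2 * m₀ + 2) * (m₀ + 1)) + 2 ≤ renewalCount (u n) γ).card
    · exact prop32Concl_case1 hk hu (by positivity) hC1
    · have hF : ∀ᶠ n in atTop, 4 * ((sparseHighBridges d (u n) v δ k).filter
          fun γ => u n / (8 * (2 * m₀ + 2) * (m₀ + 1)) + 2 ≤ renewalCount (u n) γ).card <
          (sparseHighBridges d (u n) v δ k).card := by
        simpa [Filter.not_frequently, not_le] using hC1
      exact prop32Concl_case3 Zc hk hu H3 m₀ hG hF

end Assembly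

/-- **K1-Z5/Z6 (all dimensions): `DCH_prop32` from the per-`n` counts H2/H3** supplied for every
`d ≥ 2, v > 0, k ≥ 2, δ > 0` by the zigzag-unfolding layer (blueprint stubs Z1–Z4).
[cite: DuminilCopinHammond2013, Proposition 3.2, §3 (arXiv v1, pp. 11, 13–17)] -/
theorem dch_prop32_of_counts (Zc : ∀ {d : ℕ} [NeZero d], ℕ → (ℕ → Site d) → ℕ)
    (H2 : ∀ (d : ℕ) [NeZero d], 2 ≤ d → ∀ v : ℝ, 0 < v → ∀ k : ℕ, 2 ≤ k → ∀ δ : ℝ, 0 < δ →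
      ∀ n m : ℕ, ((sparseHighBridges d n v δ k).filter (fun γ => Zc n γ ≤ m)).card ≤
        (∑ s ∈ Finset.range (2 * m + 1), (n + 1).choose s) * (sparseHighBridges d n v δ (k - 1)).card)
    (H3 : ∀ (d : ℕ) [NeZero d], 2 ≤ d → ∀ v : ℝ, 0 < v → ∀ k : ℕ, 2 ≤ k → ∀ δ : ℝ, 0 < δ →
      ∀ n L t a r : ℕ, 1 ≤ L →
        ((sparseHighBridges d n v δ k).filter
            (fun γ => a + n / (L + 1) ≤ Zc n γ ∧ renewalCount n γ ≤ r)).card * a.choose t ≤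
          ((r + 3 * L * t) * L).choose t * ((highBridges d n v).filter (fun φ => t ≤ renewalCount n φ)).card) :
    DCH_prop32 := by
  intro d _ hd v hv k hk δ hδ u hu
  exact dch_prop32At_of_counts Zc hk hδ (H2 d hd v hv k hk δ hδ) (H3 d hd v hv k hk δ hδ) u hu


end Literature.Probability.RandomPlanarGeometry.SAW.Zd

end
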